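import Literature.Barriers.CriticalPhenomena.LongRangeTrivialityOnZ3InfraredBound
import Literature.Barriers.CriticalPhenomena.LaceExpansionXSpaceAsymptotics
import Mathlib
import HarnessLib

/-!
# Saddle geometry on the fugacity torus, part 1: the continuous exponent and the unperturbed angular profile

Helper file for route `TcThermcert1`, crux `ThermalStiffnessCeilingU8b10_le_1o8` (item `stmt-Ventures-26381`), line
`Cruxes/ThermalStiffnessCeilingU8b10_le_1o8/Lines/zerofree_corridor.lean` v8, registered stub `stub_saddleGeometry` (K3b).
Model-free facts the K3b prover needs first:

§1 `exists_continuous_torus_exponent`: for `M ≠ 0`, radii `0 < r₁, r₂ < 1`, exponents `a, b` and any `h` continuous along the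
torus, the coefficient integrand `(1+z)^M (1+w)^M e^{M h(z,w)} / (z^a w^b)` at `z = r₁e^{iφ}`, `w = r₂e^{iψ}` equals `e^{M Φ(φ,ψ)}`
for the GLOBAL continuous exponent `Φ = log(1+z) + log(1+w) + h(z,w) − (a/M)(log r₁ + iφ) − (b/M)(log r₂ + iψ)` (principal
logarithms; `1 + z` lies in the slit plane because `|z| < 1`).  This is clause (i) of `stub_saddleGeometry`.

§2 the unperturbed angular profile of `|1 + r e^{iu}|`: `|1 + re^{iu}|² = 1 + r² + 2r cos u`; Jordan's inequality in the form
`2u²/π² ≤ 1 − cos u` on `|u| ≤ π` (cited from the tree, `Literature.Barriers.CriticalPhenomena`); hence the global margin `log|1 + re^{iu}| − log(1+r) ≤ −(2r/(π²(1+r)²))·u²` (`0 < r < 1`,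
`|u| ≤ π`) and the local lower companion `−(r/(2(1−r)²))·u² ≤ log|1 + re^{iu}| − log(1+r)` (all real `u`).  These feed clauses
(ii)–(iii) of the stub (two-sided quadratic real part near the critical point, uniform margin off the box) before the
`ε₁`-perturbation is switched on.

[folklore] No definitions; all statements proved; no `sorry`.
-/

noncomputable section

open Complex

namespace Summit.Ventures.CertifiedManyBodySolver.Theorems.TcThermcert1.ZeroFreeCorridor

/-! ## §1 The continuous exponent of the torus integrand -/

/-- `e^{log r + iφ} = r e^{iφ}` for `r > 0`. -/
theorem cexp_log_add_mul_I {r : ℝ} (hr : 0 < r) (φ : ℝ) :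
    cexp ((Real.log r : ℂ) + (φ : ℂ) * I) = (r : ℂ) * cexp ((φ : ℂ) * I) := by
  rw [Complex.exp_add, ← Complex.ofReal_exp, Real.exp_log hr]

/-- `1 + r e^{iφ}` lies in the slit plane for `|r| < 1`. -/
theorem one_add_circle_mem_slitPlane {r : ℝ} (hr : 0 ≤ r) (hr' : r < 1) (φ : ℝ) :
    1 + (r : ℂ) * cexp ((φ : ℂ) * I) ∈ slitPlane := by
  apply Complex.mem_slitPlane_of_norm_lt_one
  rw [norm_mul, Complex.norm_real, Complex.norm_exp_ofReal_mul_I, mul_one, Real.norm_eq_abs, abs_of_nonneg hr]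
  exact hr'

/-- `1 + r e^{iφ} ≠ 0` for `0 ≤ r < 1`. -/
theorem one_add_circle_ne_zero {r : ℝ} (hr : 0 ≤ r) (hr' : r < 1) (φ : ℝ) :
    1 + (r : ℂ) * cexp ((φ : ℂ) * I) ≠ 0 :=
  Complex.slitPlane_ne_zero (one_add_circle_mem_slitPlane hr hr' φ)

/-- **§1 — the global continuous exponent (clause (i) of `stub_saddleGeometry`).** -/
theorem exists_continuous_torus_exponent {M : ℕ} (hM : M ≠ 0) (a b : ℕ) {r₁ r₂ : ℝ}
    (hr₁ : 0 < r₁) (hr₁' : r₁ < 1) (hr₂ : 0 < r₂) (hr₂' : r₂ < 1) (h : ℂ × ℂ → ℂ)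
    (hh : Continuous fun p : ℝ × ℝ =>
      h ((r₁ : ℂ) * cexp ((p.1 : ℂ) * I), (r₂ : ℂ) * cexp ((p.2 : ℂ) * I))) :
    ∃ Φ : ℝ → ℝ → ℂ, Continuous (Function.uncurry Φ) ∧
      (∀ φ ψ : ℝ, Φ φ ψ =
        Complex.log (1 + (r₁ : ℂ) * cexp ((φ : ℂ) * I)) + Complex.log (1 + (r₂ : ℂ) * cexp ((ψ : ℂ) * I)) +
          h ((r₁ : ℂ) * cexp ((φ : ℂ) * I), (r₂ : ℂ) * cexp ((ψ : ℂ) * I)) -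
          (a : ℂ) / M * ((Real.log r₁ : ℂ) + (φ : ℂ) * I) - (b : ℂ) / M * ((Real.log r₂ : ℂ) + (ψ : ℂ) * I)) ∧
      ∀ φ ψ : ℝ,
        (1 + (r₁ : ℂ) * cexp ((φ : ℂ) * I)) ^ M * (1 + (r₂ : ℂ) * cexp ((ψ : ℂ) * I)) ^ M *
            cexp ((M : ℂ) * h ((r₁ : ℂ) * cexp ((φ : ℂ) * I), (r₂ : ℂ) * cexp ((ψ : ℂ) * I))) /
          (((r₁ : ℂ) * cexp ((φ : ℂ) * I)) ^ a * ((r₂ : ℂ) * cexp ((ψ : ℂ) * I)) ^ b) =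
        cexp ((M : ℂ) * (Complex.log (1 + (r₁ : ℂ) * cexp ((φ : ℂ) * I)) +
          Complex.log (1 + (r₂ : ℂ) * cexp ((ψ : ℂ) * I)) +
          h ((r₁ : ℂ) * cexp ((φ : ℂ) * I), (r₂ : ℂ) * cexp ((ψ : ℂ) * I)) -
          (a : ℂ) / M * ((Real.log r₁ : ℂ) + (φ : ℂ) * I) - (b : ℂ) / M * ((Real.log r₂ : ℂ) + (ψ : ℂ) * I))) := by
  refine ⟨fun φ ψ => Complex.log (1 + (r₁ : ℂ) * cexp ((φ : ℂ) * I)) +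
      Complex.log (1 + (r₂ : ℂ) * cexp ((ψ : ℂ) * I)) +
      h ((r₁ : ℂ) * cexp ((φ : ℂ) * I), (r₂ : ℂ) * cexp ((ψ : ℂ) * I)) -
      (a : ℂ) / M * ((Real.log r₁ : ℂ) + (φ : ℂ) * I) - (b : ℂ) / M * ((Real.log r₂ : ℂ) + (ψ : ℂ) * I),
    ?_, fun _ _ => rfl, fun φ ψ => ?_⟩
  · -- continuity: principal logs of points of the slit plane, `h` along the torus, affine terms
    have hc1 : Continuous fun p : ℝ × ℝ => (r₁ : ℂ) * cexp ((p.1 : ℂ) * I) := by fun_prop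
    have hc2 : Continuous fun p : ℝ × ℝ => (r₂ : ℂ) * cexp ((p.2 : ℂ) * I) := by fun_prop
    have hl1 : Continuous fun p : ℝ × ℝ => Complex.log (1 + (r₁ : ℂ) * cexp ((p.1 : ℂ) * I)) :=
      (continuous_const.add hc1).clog fun p => one_add_circle_mem_slitPlane hr₁.le hr₁' p.1
    have hl2 : Continuous fun p : ℝ × ℝ => Complex.log (1 + (r₂ : ℂ) * cexp ((p.2 : ℂ) * I)) :=
      (continuous_const.add hc2).clog fun p => one_add_circle_mem_slitPlane hr₂.le hr₂' p.2
    have ha1 : Continuous fun p : ℝ × ℝ => (a : ℂ) / M * ((Real.log r₁ : ℂ) + (p.1 : ℂ) * I) := by fun_prop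
    have ha2 : Continuous fun p : ℝ × ℝ => (b : ℂ) / M * ((Real.log r₂ : ℂ) + (p.2 : ℂ) * I) := by fun_prop
    exact (((hl1.add hl2).add hh).sub ha1).sub ha2
  · -- the product identity
    have hM' : (M : ℂ) ≠ 0 := Nat.cast_ne_zero.mpr hM
    have hz := one_add_circle_ne_zero hr₁.le hr₁' φ
    have hw := one_add_circle_ne_zero hr₂.le hr₂' ψ
    have e : (M : ℂ) * (Complex.log (1 + (r₁ : ℂ) * cexp ((φ : ℂ) * I)) +
          Complex.log (1 + (r₂ : ℂ) * cexp ((ψ : ℂ) * I)) +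
          h ((r₁ : ℂ) * cexp ((φ : ℂ) * I), (r₂ : ℂ) * cexp ((ψ : ℂ) * I)) -
          (a : ℂ) / M * ((Real.log r₁ : ℂ) + (φ : ℂ) * I) - (b : ℂ) / M * ((Real.log r₂ : ℂ) + (ψ : ℂ) * I)) =
        (M : ℂ) * Complex.log (1 + (r₁ : ℂ) * cexp ((φ : ℂ) * I)) +
          (M : ℂ) * Complex.log (1 + (r₂ : ℂ) * cexp ((ψ : ℂ) * I)) +
          (M : ℂ) * h ((r₁ : ℂ) * cexp ((φ : ℂ) * I), (r₂ : ℂ) * cexp ((ψ : ℂ) * I)) +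
          -((a : ℂ) * ((Real.log r₁ : ℂ) + (φ : ℂ) * I)) + -((b : ℂ) * ((Real.log r₂ : ℂ) + (ψ : ℂ) * I)) := by
      field_simp
      ring
    rw [e]
    simp only [Complex.exp_add, Complex.exp_neg]
    rw [Complex.exp_nat_mul (Complex.log _) M, Complex.exp_nat_mul (Complex.log _) M, Complex.exp_log hz,
      Complex.exp_log hw, Complex.exp_nat_mul _ a, Complex.exp_nat_mul _ b, cexp_log_add_mul_I hr₁, cexp_log_add_mul_I hr₂]
    rw [div_eq_mul_inv, mul_inv]
    ring

/-! ## §2 The unperturbed angular profile of `|1 + r e^{iu}|` -/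

/-- `|1 + r e^{iu}|² = 1 + r² + 2 r cos u`. -/
theorem normSq_one_add_circle (r u : ℝ) :
    ‖1 + (r : ℂ) * cexp ((u : ℂ) * I)‖ ^ 2 = 1 + r ^ 2 + 2 * r * Real.cos u := by
  rw [Complex.sq_norm, Complex.normSq_apply]
  have hre : (1 + (r : ℂ) * cexp ((u : ℂ) * I)).re = 1 + r * Real.cos u := by
    simp [Complex.exp_ofReal_mul_I_re]
  have him : (1 + (r : ℂ) * cexp ((u : ℂ) * I)).im = r * Real.sin u := by
    simp [Complex.exp_ofReal_mul_I_im]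
  rw [hre, him]
  nlinarith [Real.sin_sq_add_cos_sq u]

/- Jordan's inequality `2u²/π² ≤ 1 − cos u` (|u| ≤ π) and `1 − cos u ≤ u²/2` are cited from the tree:
`Literature.Barriers.CriticalPhenomena.LongRangeIsing.two_mul_sq_div_le_one_sub_cos`, `Literature.Barriers.CriticalPhenomena.one_sub_cos_le`. -/

/-- **§2 — the global angular margin.** For `0 < r < 1` and `|u| ≤ π`:
`log|1 + r e^{iu}| − log(1 + r) ≤ −(2r/(π²(1+r)²))·u²`. -/
theorem log_norm_one_add_circle_sub_le {r u : ℝ} (hr : 0 < r) (hr' : r < 1) (hu : |u| ≤ Real.pi) :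
    Real.log ‖1 + (r : ℂ) * cexp ((u : ℂ) * I)‖ - Real.log (1 + r) ≤
      -(2 * r / (Real.pi ^ 2 * (1 + r) ^ 2)) * u ^ 2 := by
  have hpi := Real.pi_pos
  have hN0 : 0 < ‖1 + (r : ℂ) * cexp ((u : ℂ) * I)‖ := norm_pos_iff.mpr (one_add_circle_ne_zero hr.le hr' u)
  have hsq := normSq_one_add_circle r u
  have hj := Literature.Barriers.CriticalPhenomena.LongRangeIsing.two_mul_sq_div_le_one_sub_cos hu
  -- `x := |1+re^{iu}|²/(1+r)² ≤ 1 − (4r/(π²(1+r)²)) u²` and `log x ≤ x − 1`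
  have hx : ‖1 + (r : ℂ) * cexp ((u : ℂ) * I)‖ ^ 2 / (1 + r) ^ 2 ≤
      1 - 4 * r / (Real.pi ^ 2 * (1 + r) ^ 2) * u ^ 2 := by
    rw [hsq, div_le_iff₀ (by positivity)]
    have e : (1 - 4 * r / (Real.pi ^ 2 * (1 + r) ^ 2) * u ^ 2) * (1 + r) ^ 2 =
        (1 + r) ^ 2 - 2 * r * (2 * u ^ 2 / Real.pi ^ 2) := by
      field_simp
      ring
    rw [e]
    nlinarith
  have hlog : Real.log (‖1 + (r : ℂ) * cexp ((u : ℂ) * I)‖ ^ 2 / (1 + r) ^ 2) ≤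
      -(4 * r / (Real.pi ^ 2 * (1 + r) ^ 2)) * u ^ 2 := by
    have := Real.log_le_sub_one_of_pos (x := ‖1 + (r : ℂ) * cexp ((u : ℂ) * I)‖ ^ 2 / (1 + r) ^ 2) (by positivity)
    linarith
  have hsplit : Real.log (‖1 + (r : ℂ) * cexp ((u : ℂ) * I)‖ ^ 2 / (1 + r) ^ 2) =
      2 * (Real.log ‖1 + (r : ℂ) * cexp ((u : ℂ) * I)‖ - Real.log (1 + r)) := by
    rw [Real.log_div (by positivity) (by positivity), Real.log_pow, Real.log_pow]
    push_cast
    ring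
  rw [hsplit] at hlog
  have e2 : -(2 * r / (Real.pi ^ 2 * (1 + r) ^ 2)) * u ^ 2 = (-(4 * r / (Real.pi ^ 2 * (1 + r) ^ 2)) * u ^ 2) / 2 := by
    ring
  rw [e2]
  linarith

/-- **§2 — the local lower companion.** For `0 < r < 1` and every real `u`:
`−(r/(2(1−r)²))·u² ≤ log|1 + r e^{iu}| − log(1 + r)`. -/
theorem log_norm_one_add_circle_sub_ge {r : ℝ} (hr : 0 < r) (hr' : r < 1) (u : ℝ) :
    -(r / (2 * (1 - r) ^ 2)) * u ^ 2 ≤ Real.log ‖1 + (r : ℂ) * cexp ((u : ℂ) * I)‖ - Real.log (1 + r) := by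
  have hN0 : 0 < ‖1 + (r : ℂ) * cexp ((u : ℂ) * I)‖ := norm_pos_iff.mpr (one_add_circle_ne_zero hr.le hr' u)
  have hsq := normSq_one_add_circle r u
  have hc := Literature.Barriers.CriticalPhenomena.one_sub_cos_le u
  have h1r : 0 < 1 - r := by linarith
  -- `y := |1+re^{iu}|²/(1+r)² ≥ (1−r)²/(1+r)² > 0` and `log y ≥ 1 − 1/y ≥ −(1 − y)(1+r)²/(1−r)²`, `1 − y ≤ r u²/(1+r)²`
  set y := ‖1 + (r : ℂ) * cexp ((u : ℂ) * I)‖ ^ 2 / (1 + r) ^ 2 with hy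
  have hy0 : 0 < y := by positivity
  have hylow : (1 - r) ^ 2 / (1 + r) ^ 2 ≤ y := by
    rw [hy, hsq]
    apply div_le_div_of_nonneg_right _ (by positivity)
    nlinarith [Real.neg_one_le_cos u]
  have h1y : 1 - y ≤ r * u ^ 2 / (1 + r) ^ 2 := by
    rw [hy, hsq]
    have hp : (0 : ℝ) < (1 + r) ^ 2 := by positivity
    rw [show 1 - (1 + r ^ 2 + 2 * r * Real.cos u) / (1 + r) ^ 2 = (2 * r * (1 - Real.cos u)) / (1 + r) ^ 2 by
      field_simp; ring]
    apply div_le_div_of_nonneg_right _ hp.le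
    nlinarith [mul_le_mul_of_nonneg_left hc hr.le]
  have hlog : 1 - 1 / y ≤ Real.log y := by
    have := Real.log_le_sub_one_of_pos (x := 1 / y) (by positivity)
    rw [Real.log_div (by norm_num) hy0.ne', Real.log_one, zero_sub] at this
    linarith
  have hsplit : Real.log y = 2 * (Real.log ‖1 + (r : ℂ) * cexp ((u : ℂ) * I)‖ - Real.log (1 + r)) := by
    rw [hy, Real.log_div (by positivity) (by positivity), Real.log_pow, Real.log_pow]
    push_cast
    ring
  -- `1 − 1/y = −(1−y)/y ≥ −(1−y)·(1+r)²/(1−r)² ≥ −r u²/(1−r)²`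
  have hq : 0 < (1 - r) ^ 2 / (1 + r) ^ 2 := by positivity
  have h3 : -(r * u ^ 2 / (1 - r) ^ 2) ≤ 1 - 1 / y := by
    rw [show 1 - 1 / y = -((1 - y) / y) by field_simp; ring]
    rw [neg_le_neg_iff]
    rcases le_or_gt 0 (1 - y) with hpos | hneg
    · calc (1 - y) / y ≤ (r * u ^ 2 / (1 + r) ^ 2) / ((1 - r) ^ 2 / (1 + r) ^ 2) :=
            div_le_div₀ (by positivity) h1y hq hylow
        _ = r * u ^ 2 / (1 - r) ^ 2 := by field_simp
    · calc (1 - y) / y ≤ 0 := div_nonpos_of_nonpos_of_nonneg hneg.le hy0.le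
        _ ≤ r * u ^ 2 / (1 - r) ^ 2 := by positivity
  rw [hsplit] at hlog
  have e2 : -(r / (2 * (1 - r) ^ 2)) * u ^ 2 = -(r * u ^ 2 / (1 - r) ^ 2) / 2 := by
    field_simp
  rw [e2]
  linarith

end Summit.Ventures.CertifiedManyBodySolver.Theorems.TcThermcert1.ZeroFreeCorridor

end
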